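import Literature.AlgebraicGeometry.ShimuraVarieties.UnitaryCurveAuxiliaryComplexStructure
import HarnessLib

/-!
# Positivity of Deligne's complex structure `J_Φ(v)` on `(V_M ⊗ ℝ, ψ_V)`: `−J_Φ(v) ∈ C0 δ`, `J_Φ(v) ∈ C0pm δ`
# (Deligne 1979 Prop. 2.3.10 «ψ(u, h(i)u) definite»; Milne ISV §6, §8; any rank `n`, frame-free in the negative vector `v`)

Topic `AlgebraicGeometry/ShimuraVarieties`; namespace `Literature.AlgebraicGeometry.ShimuraVarieties.UnitaryCurve.AuxV`.  THEOREMS ONLY (no `def`,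
no named fact, no instance, no notation, no `sorry`).
Cell `hodgecm-mathlib` (D-0151), FLOOR 0, P6 «MOD programme», door (E) of `stub_RGD`, organ **E2** «complex structure + period map» (LEAD F0P6-plan (g2)
2026-09-01T21:40:57Z; GEN heir A-p18 (g31) field types (F1)–(F3); census `F0/P6/A-p17/g27/CENSUS-E2-UnitaryCurveAuxiliaryPeriodMap.v1.A-p17g27.md`) =
the rank-`n`, `W₀`-FREE and FRAME-FREE form of ★ `UnitaryAuxiliaryComplexStructure` ∕ `…PeriodEigenrows` ∕ `…PeriodMap` (the case `Fin 1 ⊕ Fin 3` over the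
ball model of the hDel I-1′ road, namespace `…UnitaryCanonicalModel.Aux`, kept untouched; everything rank-free there — `realPi`, `realEmb`, `iPhi`, `embOf`,
the trace formula `Tr_{ℝ⊗M/ℝ} = 2 Re Σ_{ρ∈Φ}` — is REUSED, not re-declared).  Points are read as vectors `v ∈ ℂⁿ` NEGATIVE for `H^τ` (★ `negCone (H.map τ)`:
the currency of ★ `RecordSystemGS.hol`, of the E-line chart `AuxChartGS.Z a : (Fin 2 → ℂ) → …` and of ★ `hasHolomorphicSiegelLift_of_negConeChart`);
the rank-3 frame `T` (`Tᴴ H^τ T = diag(1,1,−1)`) and the ball model are not needed.  `--supports stmt-HodgeConjecture-24832`, count-neutral; HC_CM is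
proved only modulo the printed citations until rung 0 closes.
THIS FILE (E2 FILE A3 = §4 of the census).  The Riemann-form computation of [Deligne1979ShimuraVarieties] 2.3.10 / [Milne2005ShimuraVarieties] §8, `W₀`-free:
`E_δ(Jx, x) = ψ_{V,ℝ}(A y, y) = Tr_{ℝ⊗M/ℝ}(ᵗc(A y)·G·y) = 2 Σ_{ρ∈Φ} Re(−i·ρ(ξ)·h_ρ(y_ρ))` with `A = iPhi·s_v`, `G = 1 ⊗ ξH^j`,
`h_ρ(u) = (s_ρ u)ᴴ·H^{ρ∘j}·u ≥ 0` (`> 0` for `u ≠ 0`): at the `ρ` over `τ` because `H^τ·r_v` is positive (★ FILE A1 `star_reflH_mulVec_dotProduct_pos`,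
from the signature hypothesis `hsig`), at the other `ρ ∈ Φ` because `s_ρ = 1` and `H^{ρ∘j}` is positive definite (`hpos`; `ρ∘j` is off the place of `τ` by
★ `mk_comp_ne_mk_of_isExtAdapted`).  With the tree's sign `Im ρ(ξ) < 0` (`ρ ∈ Φ`) the form is NEGATIVE definite.
* `auxGramVR_map_realEmb`, `coe_blockGLV_iPhi_sPhiV_map_realEmb`, `star_smul_mulVec_dotProduct` (coordinates of the `ρ`-summand);
* `star_sCompV_mulVec_dotProduct_pos/_nonneg`, **`traceForm_blockGLV_mulVec_self_neg`** (`ψ_{V,ℝ}(A y, y) < 0` for `y ≠ 0`);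
* `auxComplexStructureV_mulVec_dotProduct` (`E_δ(Jx,x) = ψ_{V,ℝ}(A y, y)` through the frame), `…_neg`, **`neg_auxComplexStructureV_mem_C0`**,
  **`auxComplexStructureV_mem_C0pm`** — hypotheses: `H^τ` hermitian, `v ∈ negCone (H^τ)`, signature `(n−1,1)` at `τ` (`hsig`), `Im ρ(ξ) < 0` on `Φ`,
  `H^σ` positive definite off the place of `τ`, ★ `IsExtAdapted τ j Φ`.  (The point of ★ `C0pm δ` is `⟨J, auxComplexStructureV_mem_C0pm …⟩`.)

## References
* [Deligne1979ShimuraVarieties] P. Deligne, *Variétés de Shimura* (1979), Prop. 2.3.10 and 2.3.9 (PDF p. 32 of Milne's translation).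
* [Milne2005ShimuraVarieties] J. S. Milne, *Introduction to Shimura varieties* (2005), §6 pp. 67–70 (`X(ψ)^±`), §8 p. 81 («ψ(Ju, Jv) = ψ(u, v)»).
* [RapoportSmithlingZhang2020Diagonal] M. Rapoport, B. Smithling, W. Zhang, *Arithmetic diagonal cycles on unitary Shimura varieties*, Compos. Math.
  156 (2020), Remark 3.2 (ii)(iii) pp. 9–10, Remark 3.3 p. 10.
* [Lange2023AbelianVarietiesComplex] H. Lange, *Abelian Varieties over the Complex Numbers* (2023), §7.1.2 (7.1).
* [BergeronMillsonMoeglin2016Balls] N. Bergeron, J. Millson, C. Moeglin, Acta Math. 216 (2016), Part 2 §1.3 (negative lines).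
* [Jacobowitz1990] H. Jacobowitz, *An Introduction to CR Structures* (1990), Ch. 2 §1 (reflections for a hermitian form).
-/

set_option autoImplicit false

noncomputable section

open Matrix NumberField
open scoped TensorProduct ComplexConjugate Classical ComplexOrder

namespace Literature.AlgebraicGeometry.ShimuraVarieties

namespace UnitaryCurve

namespace AuxV

open Literature.AlgebraicGeometry.ModuliOfAbelianVarieties
open Literature.AlgebraicGeometry.Motives (CMType)
open Literature.AlgebraicGeometry.ShimuraVarieties.UnitaryCanonicalModel.Aux (IsExtAdapted conjAlgHom conjAlgHom_apply conjR conjR_tmul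
  ratBasis trace_one_tmul realPi realPiEquiv realPi_symm_apply realEmb realEmb_apply realEmb_tmul realEmb_conjR eq_of_realEmb_eq
  matrix_eq_of_realEmb_eq map_includeRight_map_realEmb map_conjR_map_realEmb iPhi iPhiVal coe_iPhi realEmb_iPhiVal iPhi_mul_self
  conjR_iPhi_mul_iPhi trace_eq_two_mul_sum_re traceForm_conjR_eq_sum realEmb_dotProduct_conjR_mulVec realEmb_comp_mulVec
  exists_realEmb_comp_ne_zero mk_comp_ne_mk_of_isExtAdapted embOf embOf_tmul realEmb_eq_embOf realEmb_apply_eq_embOf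
  embOf_eq_conj_realEmb conjugate_mem_of_not_mem embOf_iPhiVal_of_mem embOf_iPhiVal_of_not_mem)

/-! ### §4. Positivity: `-J_Φ(v) ∈ C0 δ` and `J_Φ(v) ∈ C0pm δ`

The Riemann-form computation of [Deligne1979ShimuraVarieties] 2.3.10 / [Milne2005ShimuraVarieties] §8 («ψ(u, h(i)u) definite»), `W₀`-free:
`E_δ(Jx, x) = ψ_{V,ℝ}(A y, y) = Tr_{ℝ⊗M/ℝ}(ᵗc(A y)·G·y) = 2 Σ_{ρ∈Φ} Im ρ(ξ)·h_ρ(y_ρ)` with `A = iPhi·s_v`, `G = 1 ⊗ ξH^j`,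
`h_ρ(u) = (s_ρ u)ᴴ·H^{ρ∘j}·u ≥ 0` (`> 0` for `u ≠ 0`): at the `ρ` over `τ` because `H^τ·r_v` is positive (§1, signature), at the other
`ρ ∈ Φ` because `s_ρ = 1` and `H^{ρ∘j}` is definite (`hpos`; `ρ∘j ≠ τ̄` by ★ `IsExtAdapted` and the CM-type axiom).  With the tree's sign
`Im ρ(ξ) < 0` the form is NEGATIVE definite: `-J ∈ C0 δ`, `J ∈ C0pm δ`. -/

section FormValue

variable {L : Type} [Field L] (M : Type) [Field M] [NumberField M] (j : L →+* M) (Φ : CMType M) (τ : L →+* ℂ)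
  {n : ℕ} (H : Matrix (Fin n) (Fin n) L) (ξ : M)

/-- `G_ρ = ρ(ξ)·H^{ρ∘j}`: the `ρ`-image of the Gram data `1 ⊗ ξH^j`. [cite: Deligne1979ShimuraVarieties, Prop. 2.3.10 (PDF p. 32)] -/
theorem auxGramVR_map_realEmb (ρ : Φ.1) :
    (auxGramVR M j H ξ ℝ).map (realEmb M Φ ρ) = ρ.1 ξ • H.map (ρ.1.comp j) := by
  rw [auxGramVR, map_includeRight_map_realEmb, auxGramV, smul_map, Matrix.map_map, RingHom.coe_comp]

/-- `A_ρ = i·s_ρ`: the `ρ`-image of `iPhi·s_v`. [cite: Deligne1979ShimuraVarieties, Prop. 2.3.10 (PDF p. 32)] -/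
theorem coe_blockGLV_iPhi_sPhiV_map_realEmb (ρ : Φ.1) (v : Fin n → ℂ) :
    (((blockGLV (ℝ ⊗[ℚ] M) (iPhi M Φ, sPhiV M j Φ τ H v) : GL (Fin n) (ℝ ⊗[ℚ] M)) :
        Matrix (Fin n) (Fin n) (ℝ ⊗[ℚ] M)).map (realEmb M Φ ρ)) =
      Complex.I • sCompV M j Φ τ H v ρ := by
  rw [coe_blockGLV, smul_map, coe_iPhi, realEmb_iPhiVal, coe_sPhiV, sMatV_map_realEmb]

/-- The `ρ`-summand in coordinates: `(i S u)ᴴ·(b·H′)·u = -i·(b·(S u)ᴴ·H′·u)`. [cite: Deligne1979ShimuraVarieties, Prop. 2.3.10 (PDF p. 32)] -/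
theorem star_smul_mulVec_dotProduct (S H' : Matrix (Fin n) (Fin n) ℂ) (b : ℂ) (u : Fin n → ℂ) :
    star ((Complex.I • S) *ᵥ u) ⬝ᵥ ((b • H') *ᵥ u) = -Complex.I * (b * (star (S *ᵥ u) ⬝ᵥ (H' *ᵥ u))) := by
  have hI : star Complex.I = -Complex.I := by rw [Complex.star_def, Complex.conj_I]
  rw [Matrix.smul_mulVec, Matrix.smul_mulVec, star_smul, smul_dotProduct, dotProduct_smul, hI, smul_eq_mul,
    smul_eq_mul, neg_mul]

variable [IsCMField M]

omit [NumberField M] [IsCMField M] in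
/-- **`h_ρ(u) = (s_ρ u)ᴴ·H^{ρ∘j}·u > 0` for `u ≠ 0`** at every `ρ ∈ Φ`: over `τ` by `star_reflH_mulVec_dotProduct_pos` (signature), elsewhere
because `s_ρ = 1` and `H^{ρ∘j}` is positive definite (`ρ ∘ j` is off the place of `τ` by ★ `mk_comp_ne_mk_of_isExtAdapted`).
[cite: Deligne1979ShimuraVarieties, Prop. 2.3.10 (PDF p. 32)] [cite: Milne2005ShimuraVarieties, §8 p. 81] -/
theorem star_sCompV_mulVec_dotProduct_pos (hH : (H.map τ)ᴴ = H.map τ) {v : Fin n → ℂ} (hv : v ∈ negCone (H.map τ))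
    (hsig : ∀ y : Fin n → ℂ, star v ⬝ᵥ (H.map τ *ᵥ y) = 0 → y ≠ 0 → 0 < (star y ⬝ᵥ (H.map τ *ᵥ y)).re)
    (hpos : ∀ σ : L →+* ℂ, InfinitePlace.mk σ ≠ InfinitePlace.mk τ → (H.map σ).PosDef) (hΦ : IsExtAdapted τ j Φ)
    (ρ : Φ.1) {u : Fin n → ℂ} (hu : u ≠ 0) :
    0 < star (sCompV M j Φ τ H v ρ *ᵥ u) ⬝ᵥ (H.map (ρ.1.comp j) *ᵥ u) := by
  by_cases h : ρ.1.comp j = τ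
  · rw [sCompV_of_eq _ h, h]
    exact star_reflH_mulVec_dotProduct_pos (H.map τ) hH hv hsig hu
  · rw [sCompV_of_ne _ h, Matrix.one_mulVec]
    exact (hpos _ (mk_comp_ne_mk_of_isExtAdapted M j Φ τ hΦ ρ h)).dotProduct_mulVec_pos hu

omit [NumberField M] [IsCMField M] in
/-- `h_ρ(u) ≥ 0`. [cite: Deligne1979ShimuraVarieties, Prop. 2.3.10 (PDF p. 32)] -/
theorem star_sCompV_mulVec_dotProduct_nonneg (hH : (H.map τ)ᴴ = H.map τ) {v : Fin n → ℂ} (hv : v ∈ negCone (H.map τ))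
    (hsig : ∀ y : Fin n → ℂ, star v ⬝ᵥ (H.map τ *ᵥ y) = 0 → y ≠ 0 → 0 < (star y ⬝ᵥ (H.map τ *ᵥ y)).re)
    (hpos : ∀ σ : L →+* ℂ, InfinitePlace.mk σ ≠ InfinitePlace.mk τ → (H.map σ).PosDef) (hΦ : IsExtAdapted τ j Φ)
    (ρ : Φ.1) (u : Fin n → ℂ) :
    0 ≤ star (sCompV M j Φ τ H v ρ *ᵥ u) ⬝ᵥ (H.map (ρ.1.comp j) *ᵥ u) := by
  by_cases hu : u = 0
  · rw [hu, Matrix.mulVec_zero, Matrix.mulVec_zero, dotProduct_zero]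
  · exact (star_sCompV_mulVec_dotProduct_pos M j Φ τ H hH hv hsig hpos hΦ ρ hu).le

/-- **`ψ_{V,ℝ}(A y, y) < 0` for `y ≠ 0`**, `A = iPhi·s_v`, `ψ_{V,ℝ}` the trace form of `1 ⊗ ξH^j` over `ℝ ⊗_ℚ M`: the Riemann form `ψ(u, h(i)u)`
is (negative) DEFINITE under the sign convention `Im ρ(ξ) < 0` (`ρ ∈ Φ`). [cite: Deligne1979ShimuraVarieties, Prop. 2.3.10 (PDF p. 32)]
[cite: Milne2005ShimuraVarieties, §6 p. 67 («ψ(u, h(i)u) definite»), §8 p. 81] -/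
theorem traceForm_blockGLV_mulVec_self_neg (hH : (H.map τ)ᴴ = H.map τ) {v : Fin n → ℂ} (hv : v ∈ negCone (H.map τ))
    (hsig : ∀ y : Fin n → ℂ, star v ⬝ᵥ (H.map τ *ᵥ y) = 0 → y ≠ 0 → 0 < (star y ⬝ᵥ (H.map τ *ᵥ y)).re)
    (hξ : ∀ ρ : Φ.1, (ρ.1 ξ).im < 0)
    (hpos : ∀ σ : L →+* ℂ, InfinitePlace.mk σ ≠ InfinitePlace.mk τ → (H.map σ).PosDef) (hΦ : IsExtAdapted τ j Φ)
    {y : Fin n → ℝ ⊗[ℚ] M} (hy : y ≠ 0) :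
    traceForm (conjR M ℝ) (auxGramVR M j H ξ ℝ)
        (((blockGLV (ℝ ⊗[ℚ] M) (iPhi M Φ, sPhiV M j Φ τ H v) : GL (Fin n) (ℝ ⊗[ℚ] M)) :
          Matrix (Fin n) (Fin n) (ℝ ⊗[ℚ] M)) *ᵥ y) y < 0 := by
  rw [traceForm_conjR_eq_sum M Φ]
  -- the `ρ`-summand in closed form
  have hval : ∀ ρ : Φ.1,
      star (⇑(realEmb M Φ ρ) ∘ (((blockGLV (ℝ ⊗[ℚ] M) (iPhi M Φ, sPhiV M j Φ τ H v) : GL (Fin n) (ℝ ⊗[ℚ] M)) :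
          Matrix (Fin n) (Fin n) (ℝ ⊗[ℚ] M)) *ᵥ y)) ⬝ᵥ
        ((auxGramVR M j H ξ ℝ).map (realEmb M Φ ρ) *ᵥ (⇑(realEmb M Φ ρ) ∘ y)) =
      -Complex.I * (ρ.1 ξ * (star (sCompV M j Φ τ H v ρ *ᵥ (⇑(realEmb M Φ ρ) ∘ y)) ⬝ᵥ
          (H.map (ρ.1.comp j) *ᵥ (⇑(realEmb M Φ ρ) ∘ y)))) := by
    intro ρ
    rw [realEmb_comp_mulVec, coe_blockGLV_iPhi_sPhiV_map_realEmb, auxGramVR_map_realEmb, star_smul_mulVec_dotProduct]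
  -- sign of each summand (★ `re_neg_I_mul_nonpos` with the `W₀`-term set to `0`)
  have hsgn : ∀ ρ : Φ.1, ∀ h : ℂ, 0 ≤ h →
      (-Complex.I * (ρ.1 ξ * h)).re ≤ 0 ∧ ((-Complex.I * (ρ.1 ξ * h)).re = 0 → h = 0) := by
    intro ρ h hh
    have key := Literature.AlgebraicGeometry.ShimuraVarieties.UnitaryCanonicalModel.Aux.re_neg_I_mul_nonpos
      (hξ ρ) (hξ ρ) (le_refl (0 : ℂ)) hh
    rw [mul_zero, zero_add] at key
    exact ⟨key.1, fun h0 => (key.2 h0).2⟩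
  have hle : ∀ ρ ∈ (Finset.univ : Finset Φ.1),
      (star (⇑(realEmb M Φ ρ) ∘ (((blockGLV (ℝ ⊗[ℚ] M) (iPhi M Φ, sPhiV M j Φ τ H v) : GL (Fin n) (ℝ ⊗[ℚ] M)) :
          Matrix (Fin n) (Fin n) (ℝ ⊗[ℚ] M)) *ᵥ y)) ⬝ᵥ
        ((auxGramVR M j H ξ ℝ).map (realEmb M Φ ρ) *ᵥ (⇑(realEmb M Φ ρ) ∘ y))).re ≤ 0 := by
    intro ρ _
    rw [hval ρ]
    exact (hsgn ρ _ (star_sCompV_mulVec_dotProduct_nonneg M j Φ τ H hH hv hsig hpos hΦ ρ _)).1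
  obtain ⟨ρ₀, hρ₀⟩ := exists_realEmb_comp_ne_zero M Φ hy
  have hlt : (star (⇑(realEmb M Φ ρ₀) ∘ (((blockGLV (ℝ ⊗[ℚ] M) (iPhi M Φ, sPhiV M j Φ τ H v) : GL (Fin n) (ℝ ⊗[ℚ] M)) :
          Matrix (Fin n) (Fin n) (ℝ ⊗[ℚ] M)) *ᵥ y)) ⬝ᵥ
        ((auxGramVR M j H ξ ℝ).map (realEmb M Φ ρ₀) *ᵥ (⇑(realEmb M Φ ρ₀) ∘ y))).re < 0 := by
    refine lt_of_le_of_ne (hle ρ₀ (Finset.mem_univ _)) fun h0 => hρ₀ ?_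
    rw [hval ρ₀] at h0
    have hh := (hsgn ρ₀ _ (star_sCompV_mulVec_dotProduct_nonneg M j Φ τ H hH hv hsig hpos hΦ ρ₀ _)).2 h0
    by_contra hne
    exact (star_sCompV_mulVec_dotProduct_pos M j Φ τ H hH hv hsig hpos hΦ ρ₀ hne).ne' hh
  have hsum := Finset.sum_lt_sum hle ⟨ρ₀, Finset.mem_univ _, hlt⟩
  rw [Finset.sum_const_zero] at hsum
  linarith

end FormValue

/-! #### Assembly: `-J ∈ C0 δ`, `J ∈ C0pm δ` -/

section Positivity

variable {L : Type} [Field L] {M : Type} [Field M] [NumberField M] [IsCMField M] {j : L →+* M}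
  {n : ℕ} {H : Matrix (Fin n) (Fin n) L} {ξ : M} {g : ℕ} {δ : Fin g → ℕ}
  (F : SymplecticFrameV M j H ξ g δ) (τ : L →+* ℂ) (Φ : CMType M) (v : Fin n → ℂ)

/-- **`E_δ(Jx, x) = ψ_{V,ℝ}(A y, y)`**: the value of the symplectic form on `(Jx, x)` is the trace form on the coordinates
`y ∈ (ℝ ⊗ M)^n` of `x` in the frame (`x = P_ℝ u`, `u = Q_ℝ x` the coordinates in the basis `eᵢ ⊗ (1 ⊗ b_k)`).
[cite: Deligne1979ShimuraVarieties, Prop. 2.3.10 (PDF p. 32)] [cite: Milne2005ShimuraVarieties, §8 p. 81] -/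
theorem auxComplexStructureV_mulVec_dotProduct (x : Fin g ⊕ Fin g → ℝ) :
    (auxComplexStructureV F τ Φ v *ᵥ x) ⬝ᵥ (typeFormOver δ ℝ *ᵥ x) =
      traceForm (conjR M ℝ) (auxGramVR M j H ξ ℝ)
        (((blockGLV (ℝ ⊗[ℚ] M) (iPhi M Φ, sPhiV M j Φ τ H v) : GL (Fin n) (ℝ ⊗[ℚ] M)) :
            Matrix (Fin n) (Fin n) (ℝ ⊗[ℚ] M)) *ᵥ
          (resBasis (m := Fin n) (Algebra.TensorProduct.basis ℝ (ratBasis M))).equivFun.symm (frameQVR ℝ F *ᵥ x))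
        ((resBasis (m := Fin n) (Algebra.TensorProduct.basis ℝ (ratBasis M))).equivFun.symm (frameQVR ℝ F *ᵥ x)) := by
  set rb := resBasis (m := Fin n) (Algebra.TensorProduct.basis ℝ (ratBasis M)) with hrb
  set u := frameQVR ℝ F *ᵥ x with hu
  have hx : x = framePVR ℝ F *ᵥ u := by
    rw [hu, Matrix.mulVec_mulVec, framePVR_mul_frameQVR, Matrix.one_mulVec]
  -- `J x = P (A_r u)`
  have hJ : auxComplexStructureV F τ Φ v *ᵥ x =
      framePVR ℝ F *ᵥ (resMatrix (Algebra.TensorProduct.basis ℝ (ratBasis M))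
        (((blockGLV (ℝ ⊗[ℚ] M) (iPhi M Φ, sPhiV M j Φ τ H v) : GL (Fin n) (ℝ ⊗[ℚ] M)) :
          Matrix (Fin n) (Fin n) (ℝ ⊗[ℚ] M))) *ᵥ u) := by
    rw [auxComplexStructureV_def, auxRepV, MonoidHom.comp_apply, MonoidHom.comp_apply, coe_conjRect, coe_resGL, hu,
      Matrix.mulVec_mulVec, Matrix.mulVec_mulVec]
  -- `(P w) ⬝ (E (P u)) = w ⬝ (ᵗP E P u) = w ⬝ (G u)`
  have hPEP : ∀ w : Fin n × Fin (Module.finrank ℚ M) → ℝ,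
      (framePVR ℝ F *ᵥ w) ⬝ᵥ (typeFormOver δ ℝ *ᵥ (framePVR ℝ F *ᵥ u)) =
        w ⬝ᵥ (traceGram (m := Fin n) (conjR M ℝ) (auxGramVR M j H ξ ℝ)
          (Algebra.TensorProduct.basis ℝ (ratBasis M)) *ᵥ u) := by
    intro w
    rw [traceGramV_baseChange_eq_frame ℝ F, ← Matrix.mulVec_mulVec, ← Matrix.mulVec_mulVec, Matrix.dotProduct_mulVec w,
      Matrix.vecMul_transpose]
  rw [hJ, hx, hPEP, traceGram, LinearMap.BilinForm.dotProduct_toMatrix_mulVec, ← toMatrix_resBasis_mulVecLin, ← hrb]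
  -- `rb.equivFun.symm (A_r u) = A (rb.equivFun.symm u)`
  have hsymm : ∀ z : Fin n → ℝ ⊗[ℚ] M, rb.equivFun.symm ⇑(rb.repr z) = z := fun z =>
    rb.equivFun.symm_apply_apply z
  have hux : u = ⇑(rb.repr (rb.equivFun.symm u)) := by
    funext p
    rw [← Module.Basis.equivFun_apply, LinearEquiv.apply_symm_apply]
  conv_lhs => rw [hux, LinearMap.toMatrix_mulVec_repr, hsymm, hsymm]
  rfl

/-- **`E_δ(Jx, x) < 0` for `x ≠ 0`** under the sign conventions. [cite: Deligne1979ShimuraVarieties, Prop. 2.3.10 (PDF p. 32)]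
[cite: Milne2005ShimuraVarieties, §6 p. 68, §8 p. 81] -/
theorem auxComplexStructureV_mulVec_dotProduct_neg (hH : (H.map τ)ᴴ = H.map τ) (hv : v ∈ negCone (H.map τ))
    (hsig : ∀ y : Fin n → ℂ, star v ⬝ᵥ (H.map τ *ᵥ y) = 0 → y ≠ 0 → 0 < (star y ⬝ᵥ (H.map τ *ᵥ y)).re)
    (hξ : ∀ ρ : Φ.1, (ρ.1 ξ).im < 0)
    (hpos : ∀ σ : L →+* ℂ, InfinitePlace.mk σ ≠ InfinitePlace.mk τ → (H.map σ).PosDef) (hΦ : IsExtAdapted τ j Φ)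
    {x : Fin g ⊕ Fin g → ℝ} (hx : x ≠ 0) :
    (auxComplexStructureV F τ Φ v *ᵥ x) ⬝ᵥ (typeFormOver δ ℝ *ᵥ x) < 0 := by
  rw [auxComplexStructureV_mulVec_dotProduct]
  refine traceForm_blockGLV_mulVec_self_neg M j Φ τ H ξ hH hv hsig hξ hpos hΦ fun hy => hx ?_
  have hu : frameQVR ℝ F *ᵥ x = 0 := by
    have := congrArg (resBasis (m := Fin n) (Algebra.TensorProduct.basis ℝ (ratBasis M))).equivFun hy
    rwa [LinearEquiv.apply_symm_apply, map_zero] at this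
  calc x = framePVR ℝ F *ᵥ (frameQVR ℝ F *ᵥ x) := by rw [Matrix.mulVec_mulVec, framePVR_mul_frameQVR, Matrix.one_mulVec]
    _ = 0 := by rw [hu, Matrix.mulVec_zero]

/-- **`-J_Φ(v) ∈ C0 δ`**: `-J` is a symplectic complex structure with `ᵗ(-J)·E_δ` positive definite (Lange's `X⁺` half), i.e. `E_δ(Jx, x) < 0`
— the sign the tree's convention `Im ρ(ξ) < 0` produces.  Hypotheses: `H^τ` hermitian, `v` in its negative cone, signature `(n−1,1)` at `τ` (`hsig`),
`H^σ` positive definite off the place of `τ`, ★ `IsExtAdapted τ j Φ`.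
[cite: Deligne1979ShimuraVarieties, Prop. 2.3.10 (PDF p. 32)] [cite: Milne2005ShimuraVarieties, §6 p. 68, §8 p. 81]
[cite: Lange2023AbelianVarietiesComplex, §7.1.2 (7.1) (p0326–p0327)] -/
theorem neg_auxComplexStructureV_mem_C0 (hH : (H.map τ)ᴴ = H.map τ) (hv : v ∈ negCone (H.map τ))
    (hsig : ∀ y : Fin n → ℂ, star v ⬝ᵥ (H.map τ *ᵥ y) = 0 → y ≠ 0 → 0 < (star y ⬝ᵥ (H.map τ *ᵥ y)).re)
    (hξ : ∀ ρ : Φ.1, (ρ.1 ξ).im < 0)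
    (hpos : ∀ σ : L →+* ℂ, InfinitePlace.mk σ ≠ InfinitePlace.mk τ → (H.map σ).PosDef) (hΦ : IsExtAdapted τ j Φ) :
    -auxComplexStructureV F τ Φ v ∈ SiegelModuli.C0 δ := by
  have hS := isSymplecticComplexStructure_auxComplexStructureV F τ Φ v hH
  set J := auxComplexStructureV F τ Φ v with hJdef
  have hEJ : SiegelModuli.realTypeForm δ * J = -(Jᵀ * SiegelModuli.realTypeForm δ) := by
    calc SiegelModuli.realTypeForm δ * J = Jᵀ * SiegelModuli.realTypeForm δ * J * J := by rw [hS.transpose_mul_mul]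
      _ = Jᵀ * SiegelModuli.realTypeForm δ * (J * J) := by simp only [Matrix.mul_assoc]
      _ = -(Jᵀ * SiegelModuli.realTypeForm δ) := by rw [hS.mul_self, Matrix.mul_neg, Matrix.mul_one]
  refine ⟨⟨by rw [neg_mul_neg, hS.mul_self], by rw [Matrix.transpose_neg, Matrix.neg_mul, neg_mul_neg, hS.transpose_mul_mul]⟩,
    Matrix.PosDef.of_dotProduct_mulVec_pos ?_ fun x hx => ?_⟩
  · -- symmetry of `ᵗ(-J) E`
    rw [Matrix.IsHermitian, Matrix.conjTranspose_eq_transpose_of_trivial, Matrix.transpose_mul, Matrix.transpose_transpose,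
      SiegelModuli.transpose_realTypeForm, neg_mul_neg, hEJ, Matrix.transpose_neg, Matrix.neg_mul]
  · rw [star_trivial, Matrix.transpose_neg, Matrix.neg_mul, Matrix.neg_mulVec, dotProduct_neg, ← Matrix.mulVec_mulVec,
      Matrix.dotProduct_mulVec, Matrix.vecMul_transpose, ← typeFormOver_real_eq_realTypeForm]
    exact neg_pos.2 (auxComplexStructureV_mulVec_dotProduct_neg F τ Φ v hH hv hsig hξ hpos hΦ hx)

/-- **`J_Φ(v) ∈ C0pm δ = X`**: the complex structure of [Deligne1979ShimuraVarieties] 2.3.10 at a negative vector `v` is a point of the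
`GSp_δ(ℝ)`-conjugacy class `X = X⁺ ⊔ X⁻` of ★ `SiegelShimuraSet` (in the `X⁻` half for the tree's sign conventions).
[cite: Deligne1979ShimuraVarieties, Prop. 2.3.10 (PDF p. 32)] [cite: Milne2005ShimuraVarieties, §6 pp. 68–70, §8 p. 81] -/
theorem auxComplexStructureV_mem_C0pm (hH : (H.map τ)ᴴ = H.map τ) (hv : v ∈ negCone (H.map τ))
    (hsig : ∀ y : Fin n → ℂ, star v ⬝ᵥ (H.map τ *ᵥ y) = 0 → y ≠ 0 → 0 < (star y ⬝ᵥ (H.map τ *ᵥ y)).re)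
    (hξ : ∀ ρ : Φ.1, (ρ.1 ξ).im < 0)
    (hpos : ∀ σ : L →+* ℂ, InfinitePlace.mk σ ≠ InfinitePlace.mk τ → (H.map σ).PosDef) (hΦ : IsExtAdapted τ j Φ) :
    auxComplexStructureV F τ Φ v ∈ C0pm δ :=
  Or.inr (neg_auxComplexStructureV_mem_C0 F τ Φ v hH hv hsig hξ hpos hΦ)

end Positivity

end AuxV

end UnitaryCurve

end Literature.AlgebraicGeometry.ShimuraVarieties

end
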